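import Summits.AnomalousDissipation.AnomalousDissipation.Theses.WindLine
import Summits.AnomalousDissipation.AnomalousDissipation.Theorems.WindLineWindyShoreUniformMap

/-!
# The ν-uniform windy shore at Galerkin level (`WindLine.WindyShoreUniform`, item
stmt-AnomalousDissipation-11419)

For `S = freqBall N`, real solenoidal force coefficients `g` with no mean mode and a direction
`e` non-resonant on `S`, the windy steady Galerkin states `c` (zeros of `galerkinRHS S ν g` in
`galerkinSubspace S` with mean mode `c₀ = s·e`) are, for `|s|` large, produced by a contraction:
writing `c = s·e ⊕ c̃`, the equations at `k ≠ 0` read `M_k c_k = Π_k (g_k − B̃(c̃,c̃)_k)` with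
`M_k = 4π²ν|k|² + 2πi s(e·k)`, `|M_k| ≥ 2π|s|δ`, `δ = min_{k∈S∖0}|e·k| > 0`, uniformly in `ν`
(its sign is not even used), and the `k = 0` equation holds identically
(`galerkinRHS_of_eq_zero`). Banach's fixed point theorem (Mathlib
`ContractingWith.exists_fixedPoint'`) for the map `Φ` of `WindLineWindyShoreUniformMap` on the
closed set `{c real solenoidal, c₀ = s·e, ‖c̃‖_∞ ≤ ‖g‖_∞/(π|s|δ)}` gives existence with
`s²·Σ_{k≠0}‖c_k‖² ≤ #S ‖g‖_∞²/(π²δ²)`, and the Lipschitz estimate of `B̃` gives uniqueness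
among states of wake energy `≤ R` once `|s| ≥ 1 + 2L‖g‖_∞/(π²δ²) + 2L√R/(πδ)`,
`L = 2π #S Σ_{m∈S}Σⱼ|mⱼ|` (Temam 1979, Ch. II, §1, Thm. 1.3 — uniqueness of steady states by
contraction — run in the wind `s` instead of the viscosity; Robinson–Rodrigo–Sadowski 2016,
§4.1; Constantin–Foias 1988, Ch. 8).
-/

set_option linter.dupNamespace false

open scoped BigOperators ComplexConjugate NNReal ENNReal
open Literature.Analysis.FluidPDE Literature.Analysis.FluidPDE.Torus
open Literature.Analysis.FunctionSpaces Literature.Analysis.FunctionSpaces.Torus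
open Set Filter Topology Metric

namespace Summit.AnomalousDissipation.AnomalousDissipation.Theorems.WindLine

variable {S : Finset (Fin 3 → ℤ)} {ν s : ℝ} {e : EuclideanSpace ℝ (Fin 3)}
  {g : ↥S → EuclideanSpace ℂ (Fin 3)}

/-! ## Fixed points of the map are the windy steady states -/

/-- **The mean-mode equation is automatic**: `V(c)_0 = 0` for real divergence-free `c` when the
force has no mean mode (no Stokes damping at `k = 0`, `Π_0 = id`, and the convection symbol has
no mean output). [folklore] -/
theorem galerkinRHS_of_eq_zero (hS : ∀ k ∈ S, -k ∈ S)
    (hg0 : ∀ k : ↥S, (k : Fin 3 → ℤ) = 0 → g k = 0) {c : ↥S → EuclideanSpace ℂ (Fin 3)}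
    (hc : c ∈ galerkinSubspace S) {k : ↥S} (hk : (k : Fin 3 → ℤ) = 0) :
    galerkinRHS S ν g c k = 0 := by
  rw [galerkinRHS_apply, galerkinField_def, coeffExt_coe, coeffExt_coe, hg0 k hk, hk,
    freqNormSq_zero, convectionCoeff_zero_eq_zero (hc.1.isConjSymm_coeffExt hS)
      hc.2.isTransversal_coeffExt]
  simp

section Phi

variable {W : (↥S → EuclideanSpace ℂ (Fin 3)) → ↥S → EuclideanSpace ℂ (Fin 3)}
  {M : (Fin 3 → ℤ) → ℂ} {Φ : (↥S → EuclideanSpace ℂ (Fin 3)) → ↥S → EuclideanSpace ℂ (Fin 3)}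
  (hW : ∀ c k, W c k = if (k : Fin 3 → ℤ) = 0 then 0 else c k)
  (hM : ∀ k, M k = ((ν * (4 * Real.pi ^ 2 * freqNormSq k) : ℝ) : ℂ) +
    2 * Real.pi * Complex.I * ((s * ∑ i, e i * (k i : ℝ) : ℝ) : ℂ))
  (hΦ : ∀ c k, Φ c k = if (k : Fin 3 → ℤ) = 0 then (s : ℂ) • EuclideanSpace.complexify e
    else (M k)⁻¹ • leraySym (k : Fin 3 → ℤ)
      (g k - convectionCoeff S (coeffExt S (W c)) (coeffExt S (W c)) k))

include hW hM in
/-- **The windy Galerkin equations away from the mean mode**: for a real divergence-free `c`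
with mean mode `s·e`, `V(c)_k = −M_k c_k + Π_k (g_k − B̃(c̃,c̃)_k)` (`k ≠ 0`): the `l = 0`
convection terms are the wind `2πi s(e·k) c_k`, absorbed into `M_k`. [folklore] -/
theorem galerkinRHS_of_ne_zero (h0 : (0 : Fin 3 → ℤ) ∈ S) {c : ↥S → EuclideanSpace ℂ (Fin 3)}
    (hc : c ∈ galerkinSubspace S) (hc0 : c ⟨0, h0⟩ = (s : ℂ) • EuclideanSpace.complexify e)
    {k : ↥S} (hk : (k : Fin 3 → ℤ) ≠ 0) :
    galerkinRHS S ν g c k = -(M k • c k) +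
      leraySym (k : Fin 3 → ℤ) (g k - convectionCoeff S (coeffExt S (W c)) (coeffExt S (W c)) k) := by
  have hwind : (2 * Real.pi * Complex.I * ∑ j, c ⟨0, h0⟩ j * ((k : Fin 3 → ℤ) j : ℂ)) =
      2 * Real.pi * Complex.I * ((s * ∑ i, e i * ((k : Fin 3 → ℤ) i : ℝ) : ℝ) : ℂ) := by
    rw [hc0]
    congr 1
    simp only [PiLp.smul_apply, EuclideanSpace.complexify_apply, smul_eq_mul]
    push_cast
    rw [Finset.mul_sum]
    exact Finset.sum_congr rfl fun j _ => by ring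
  rw [galerkinRHS_apply, galerkinField_def, coeffExt_coe, coeffExt_coe,
    convectionCoeff_coeffExt_split hW h0 c, hwind, coeffExt_coe, wake_of_ne_zero hW c hk, ← sub_sub,
    leraySym_sub _ _ (_ • _), leraySym_smul, leraySym_of_transversal (hc.2 k), hM, add_smul]
  abel

include hW hM hΦ in
/-- **Fixed points are windy steady states**: a real divergence-free fixed point of `Φ` has mean
mode `s·e` and is a zero of the Galerkin field (the multipliers `M_k`, `k ∈ S ∖ 0`, being
nonzero). [folklore] -/
theorem galerkinRHS_eq_zero_of_isFixedPt (hS : ∀ k ∈ S, -k ∈ S) (h0 : (0 : Fin 3 → ℤ) ∈ S)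
    (hg0 : ∀ k : ↥S, (k : Fin 3 → ℤ) = 0 → g k = 0)
    (hM0 : ∀ k : ↥S, (k : Fin 3 → ℤ) ≠ 0 → M k ≠ 0)
    {c : ↥S → EuclideanSpace ℂ (Fin 3)} (hc : c ∈ galerkinSubspace S) (hfix : Φ c = c) :
    c ⟨0, h0⟩ = (s : ℂ) • EuclideanSpace.complexify e ∧ galerkinRHS S ν g c = 0 := by
  have hc0 : c ⟨0, h0⟩ = (s : ℂ) • EuclideanSpace.complexify e := by
    have h := congr_fun hfix ⟨0, h0⟩
    rw [Phi_of_eq_zero hΦ c rfl] at h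
    exact h.symm
  refine ⟨hc0, funext fun k => ?_⟩
  by_cases hk : (k : Fin 3 → ℤ) = 0
  · exact galerkinRHS_of_eq_zero hS hg0 hc hk
  · have h := congr_fun hfix k
    rw [Phi_of_ne_zero hΦ c hk] at h
    rw [Pi.zero_apply, galerkinRHS_of_ne_zero hW hM h0 hc hc0 hk, ← h, smul_smul,
      mul_inv_cancel₀ (hM0 k hk), one_smul, neg_add_cancel]

include hW hM hΦ in
/-- **Windy steady states are fixed points**: a real divergence-free zero of the Galerkin field
with mean mode `s·e` is fixed by `Φ`. [folklore] -/
theorem isFixedPt_of_galerkinRHS_eq_zero (h0 : (0 : Fin 3 → ℤ) ∈ S)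
    (hM0 : ∀ k : ↥S, (k : Fin 3 → ℤ) ≠ 0 → M k ≠ 0) {c : ↥S → EuclideanSpace ℂ (Fin 3)}
    (hc : c ∈ galerkinSubspace S) (hc0 : c ⟨0, h0⟩ = (s : ℂ) • EuclideanSpace.complexify e)
    (hzero : galerkinRHS S ν g c = 0) : Φ c = c := by
  funext k
  by_cases hk : (k : Fin 3 → ℤ) = 0
  · rw [Phi_of_eq_zero hΦ c hk, show k = ⟨0, h0⟩ from Subtype.ext hk, hc0]
  · have h := congr_fun hzero k
    rw [Pi.zero_apply, galerkinRHS_of_ne_zero hW hM h0 hc hc0 hk, neg_add_eq_zero] at h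
    rw [Phi_of_ne_zero hΦ c hk, ← h, smul_smul, inv_mul_cancel₀ (hM0 k hk), one_smul]

end Phi

/-! ## Arithmetic of the thresholds -/

/-- The numerical heart of the contraction: with `a = π|s|δ`, `2L‖g‖ ≤ a²` makes `Φ` a
`½`-contraction of the wake ball of radius `‖g‖/a` into itself. [folklore] -/
theorem contraction_arith {L G a : ℝ} (hG : 0 ≤ G) (ha : 0 < a) (h : 2 * L * G ≤ a ^ 2) :
    (2 * a)⁻¹ * (L * (G / a + G / a)) ≤ 1 / 2 ∧ (2 * a)⁻¹ * (G + L * (G / a) ^ 2) ≤ G / a := by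
  constructor
  · rw [inv_mul_le_iff₀ (by positivity)]
    calc L * (G / a + G / a) = (2 * L * G) / a := by ring
      _ ≤ a ^ 2 / a := by gcongr
      _ = 2 * a * (1 / 2) := by field_simp
  · rw [inv_mul_le_iff₀ (by positivity)]
    have h1 : 2 * a * (G / a) = G + G := by field_simp; ring
    rw [h1]
    gcongr
    calc L * (G / a) ^ 2 = (L * G) * G / a ^ 2 := by ring
      _ ≤ (a ^ 2 / 2) * G / a ^ 2 := by gcongr; linarith
      _ = G / 2 := by field_simp
      _ ≤ G := by linarith

/-- The numerical heart of uniqueness: with `a = π|s|δ`, `2L√R ≤ a` makes `Φ` a `½`-contraction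
on pairs of wake energy `≤ R`. [folklore] -/
theorem uniqueness_arith {L r a : ℝ} (ha : 0 < a) (h : 2 * L * r ≤ a) :
    (2 * a)⁻¹ * (L * (r + r)) ≤ 1 / 2 := by
  rw [inv_mul_le_iff₀ (by positivity)]
  linarith [show L * (r + r) = 2 * L * r by ring]

/-! ## The theorem -/

/-- **The ν-uniform windy shore at Galerkin level** (route WindLine, support
`WindyShoreUniform`, item stmt-AnomalousDissipation-11419): for `S = freqBall N`, real solenoidal
`g` with `g₀ = 0` and `e` non-resonant on `S` there is `C` such that for every `R` there is `s₀`
with: for all `ν ≥ 0` and `|s| ≥ s₀` a windy steady state with mean mode `s·e` and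
`s² Σ_{k≠0}‖c_k‖² ≤ C` exists, and it is the only windy steady state at `(ν, s)` among those of
wake energy `≤ R`. Proof: Banach's fixed point theorem for the map `Φ` of
`WindLineWindyShoreUniformMap` on `{c real solenoidal, c₀ = s·e, ‖c̃‖_∞ ≤ ‖g‖_∞/(π|s|δ)}`,
`δ = min_{S∖0}|e·k|`, using `|M_k| ≥ 2π|s|δ` (uniform in `ν`) and the Lipschitz bound of the
convection symbol; `C = #S ‖g‖_∞²/(π²δ²)`, `s₀ = 1 + 2L‖g‖_∞/(π²δ²) + 2L√R/(πδ)`. [folklore] -/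
theorem _root_.Summit.AnomalousDissipation.AnomalousDissipation.Theorems.windyShoreUniform_proof :
    Summit.AnomalousDissipation.AnomalousDissipation.Theses.WindLine.WindyShoreUniform := by
  intro N S hSN g hg hg0 e he
  -- structural facts about `S = freqBall N`
  have h0 : (0 : Fin 3 → ℤ) ∈ S := by rw [hSN]; exact zero_mem_freqBall N
  have hS : ∀ k ∈ S, -k ∈ S := fun k hk => by rw [hSN] at hk ⊢; exact neg_mem_freqBall.2 hk
  obtain ⟨δ, hδ, hδle⟩ := exists_gap e he
  -- the wake map, through its defining equation
  obtain ⟨W, hW⟩ : ∃ W : (↥S → EuclideanSpace ℂ (Fin 3)) → ↥S → EuclideanSpace ℂ (Fin 3),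
      ∀ c k, W c k = if (k : Fin 3 → ℤ) = 0 then 0 else c k :=
    ⟨fun c k => if (k : Fin 3 → ℤ) = 0 then 0 else c k, fun _ _ => rfl⟩
  have hWc : Continuous W := by
    refine continuous_pi fun k => ?_
    by_cases hk : (k : Fin 3 → ℤ) = 0
    · simp only [hW, hk, if_true]; exact continuous_const
    · simp only [hW, hk, if_false]; exact continuous_apply k
  set L : ℝ := 2 * Real.pi * (S.card * ∑ m ∈ S, ∑ j, |(m j : ℝ)|) with hL
  have hL0 : 0 ≤ L := by positivity
  refine ⟨S.card * (‖g‖ / (Real.pi * δ)) ^ 2, fun R => ⟨1 + 2 * L * ‖g‖ / (Real.pi ^ 2 * δ ^ 2) +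
    2 * L * Real.sqrt R / (Real.pi * δ), fun ν _hν s hs => ?_⟩⟩
  -- the multiplier and the fixed-point map at `(ν, s)`, through their defining equations
  obtain ⟨M, hM⟩ : ∃ M : (Fin 3 → ℤ) → ℂ, ∀ k, M k =
      ((ν * (4 * Real.pi ^ 2 * freqNormSq k) : ℝ) : ℂ) +
        2 * Real.pi * Complex.I * ((s * ∑ i, e i * (k i : ℝ) : ℝ) : ℂ) := ⟨_, fun _ => rfl⟩
  obtain ⟨Φ, hΦ⟩ : ∃ Φ : (↥S → EuclideanSpace ℂ (Fin 3)) → ↥S → EuclideanSpace ℂ (Fin 3),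
      ∀ c k, Φ c k = if (k : Fin 3 → ℤ) = 0 then (s : ℂ) • EuclideanSpace.complexify e
        else (M k)⁻¹ • leraySym (k : Fin 3 → ℤ)
          (g k - convectionCoeff S (coeffExt S (W c)) (coeffExt S (W c)) k) :=
    ⟨fun c k => if (k : Fin 3 → ℤ) = 0 then (s : ℂ) • EuclideanSpace.complexify e
        else (M k)⁻¹ • leraySym (k : Fin 3 → ℤ)
          (g k - convectionCoeff S (coeffExt S (W c)) (coeffExt S (W c)) k), fun _ _ => rfl⟩
  -- consequences of `s₀ ≤ |s|`
  have hT2 : 0 ≤ 2 * L * ‖g‖ / (Real.pi ^ 2 * δ ^ 2) := by positivity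
  have hT3 : 0 ≤ 2 * L * Real.sqrt R / (Real.pi * δ) := by positivity
  have hs1 : 1 ≤ |s| := by linarith
  set a : ℝ := Real.pi * (|s| * δ) with ha
  have hapos : 0 < a := by positivity
  have hLg : 2 * L * ‖g‖ ≤ a ^ 2 := by
    have h1 : 2 * L * ‖g‖ ≤ |s| * (Real.pi ^ 2 * δ ^ 2) :=
      (div_le_iff₀ (by positivity)).1 (by linarith)
    have h2 : |s| * (Real.pi ^ 2 * δ ^ 2) ≤ |s| ^ 2 * (Real.pi ^ 2 * δ ^ 2) := by
      gcongr; nlinarith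
    calc 2 * L * ‖g‖ ≤ |s| ^ 2 * (Real.pi ^ 2 * δ ^ 2) := h1.trans h2
      _ = a ^ 2 := by rw [ha]; ring
  have hLR : 2 * L * Real.sqrt R ≤ a := by
    have h1 : 2 * L * Real.sqrt R ≤ |s| * (Real.pi * δ) :=
      (div_le_iff₀ (by positivity)).1 (by linarith)
    calc 2 * L * Real.sqrt R ≤ |s| * (Real.pi * δ) := h1
      _ = a := by rw [ha]; ring
  -- the lower bound on the multipliers, uniform in `ν`
  have hβle : ∀ k : ↥S, (k : Fin 3 → ℤ) ≠ 0 → 2 * a ≤ ‖M k‖ := fun k hk =>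
    calc 2 * a = 2 * Real.pi * (|s| * δ) := by rw [ha]; ring
      _ ≤ 2 * Real.pi * (|s| * |∑ i, e i * ((k : Fin 3 → ℤ) i : ℝ)|) := by
          gcongr; exact hδle k hk
      _ ≤ ‖M k‖ := advection_le_norm_mult hM k
  have h2a : 0 < 2 * a := by positivity
  have hM0 : ∀ k : ↥S, (k : Fin 3 → ℤ) ≠ 0 → M k ≠ 0 := fun k hk =>
    norm_pos_iff.1 (h2a.trans_le (hβle k hk))
  constructor
  · ------------------------------------------------------------------ existence
    set ρ : ℝ := ‖g‖ / a with hρ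
    have hρ0 : 0 ≤ ρ := by positivity
    obtain ⟨hq, hmaps_num⟩ := contraction_arith (norm_nonneg g) hapos hLg
    set T : Set (↥S → EuclideanSpace ℂ (Fin 3)) := {c | c ∈ galerkinSubspace S ∧
      c ⟨0, h0⟩ = (s : ℂ) • EuclideanSpace.complexify e ∧ ‖W c‖ ≤ ρ} with hT
    have hmaps : MapsTo Φ T T := by
      intro c hc
      refine ⟨Phi_mem hW hM hΦ hS hg hc.1, Phi_of_eq_zero hΦ c rfl, ?_⟩
      calc ‖W (Φ c)‖ ≤ (2 * a)⁻¹ * (‖g‖ + L * ‖W c‖ ^ 2) := norm_wake_Phi_le hW hΦ h2a hβle hL c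
        _ ≤ (2 * a)⁻¹ * (‖g‖ + L * ρ ^ 2) := by gcongr; exact hc.2.2
        _ ≤ ρ := hmaps_num
    have hcontr : ContractingWith (1 / 2) (hmaps.restrict Φ T T) := by
      refine ⟨NNReal.half_lt_self one_ne_zero, LipschitzWith.of_dist_le_mul fun x y => ?_⟩
      rw [Subtype.dist_eq, MapsTo.val_restrict_apply, MapsTo.val_restrict_apply, Subtype.dist_eq,
        dist_eq_norm, dist_eq_norm]
      calc ‖Φ x - Φ y‖
          ≤ (2 * a)⁻¹ * (L * (‖W x‖ + ‖W y‖)) * ‖(x : ↥S → EuclideanSpace ℂ (Fin 3)) - y‖ :=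
            norm_Phi_sub_Phi_le hW hΦ h2a hβle hL _ _
        _ ≤ (2 * a)⁻¹ * (L * (ρ + ρ)) * ‖(x : ↥S → EuclideanSpace ℂ (Fin 3)) - y‖ := by
            gcongr; exacts [x.2.2.2, y.2.2.2]
        _ ≤ ((1 / 2 : ℝ≥0) : ℝ) * ‖(x : ↥S → EuclideanSpace ℂ (Fin 3)) - y‖ := by
            push_cast
            exact mul_le_mul_of_nonneg_right hq (norm_nonneg _)
    have hTclosed : IsClosed T := by
      have h1 : IsClosed (↑(galerkinSubspace S) : Set (↥S → EuclideanSpace ℂ (Fin 3))) :=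
        (galerkinSubspace S).closed_of_finiteDimensional
      have h2 : IsClosed {c : ↥S → EuclideanSpace ℂ (Fin 3) |
          c ⟨0, h0⟩ = (s : ℂ) • EuclideanSpace.complexify e} :=
        isClosed_eq (continuous_apply _) continuous_const
      have h3 : IsClosed {c : ↥S → EuclideanSpace ℂ (Fin 3) | ‖W c‖ ≤ ρ} :=
        isClosed_le (continuous_norm.comp hWc) continuous_const
      exact h1.inter (h2.inter h3)
    -- the starting point: the bare wind
    set x₀ : ↥S → EuclideanSpace ℂ (Fin 3) :=
      fun k => if (k : Fin 3 → ℤ) = 0 then (s : ℂ) • EuclideanSpace.complexify e else 0 with hx₀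
    have hwx₀ : W x₀ = 0 := by
      funext k
      by_cases hk : (k : Fin 3 → ℤ) = 0 <;> simp [hW, hx₀, hk]
    have hx₀T : x₀ ∈ T := by
      refine ⟨⟨?_, ?_⟩, by simp [hx₀], by rw [hwx₀, norm_zero]; exact hρ0⟩
      · intro k l h
        by_cases hk : (k : Fin 3 → ℤ) = 0
        · have hl : (l : Fin 3 → ℤ) = 0 := by rw [h, hk, neg_zero]
          simp only [hx₀, hk, hl, if_true]
          exact (conjVec_wind s e).symm
        · have hl : (l : Fin 3 → ℤ) ≠ 0 := fun hl =>
            hk (by rw [← neg_neg (k : Fin 3 → ℤ), ← h, hl, neg_zero])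
          simp [hx₀, hk, hl]
      · intro k
        by_cases hk : (k : Fin 3 → ℤ) = 0
        · simp [hk]
        · simp [hx₀, hk]
    obtain ⟨c, hcT, hfix, -, -⟩ :=
      ContractingWith.exists_fixedPoint' hTclosed.isComplete hmaps hcontr hx₀T (edist_ne_top _ _)
    obtain ⟨hc0, hzero⟩ := galerkinRHS_eq_zero_of_isFixedPt hW hM hΦ hS h0 hg0 hM0 hcT.1 hfix.eq
    refine ⟨c, hcT.1, fun k hk => ?_, hzero, ?_⟩
    · rw [show k = ⟨0, h0⟩ from Subtype.ext hk]; exact hc0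
    · have hsa : |s| * ρ = ‖g‖ / (Real.pi * δ) := by
        rw [hρ, ha]; field_simp
      calc s ^ 2 * ∑ k : ↥S, (if (k : Fin 3 → ℤ) = 0 then 0 else ‖c k‖ ^ 2)
          ≤ s ^ 2 * (S.card * ‖W c‖ ^ 2) := by gcongr; exact wakeEnergy_le hW c
        _ ≤ s ^ 2 * (S.card * ρ ^ 2) := by gcongr; exact hcT.2.2
        _ = S.card * (|s| * ρ) ^ 2 := by rw [mul_pow, sq_abs]; ring
        _ = S.card * (‖g‖ / (Real.pi * δ)) ^ 2 := by rw [hsa]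
  · ------------------------------------------------------------------ uniqueness
    intro c hc c' hc' hc0 hc'0 hz hz' hR hR'
    have hfix := isFixedPt_of_galerkinRHS_eq_zero hW hM hΦ h0 hM0 hc (hc0 _ rfl) hz
    have hfix' := isFixedPt_of_galerkinRHS_eq_zero hW hM hΦ h0 hM0 hc' (hc'0 _ rfl) hz'
    have hw : ‖W c‖ ≤ Real.sqrt R :=
      (le_abs_self _).trans (Real.abs_le_sqrt ((norm_wake_sq_le hW c).trans hR))
    have hw' : ‖W c'‖ ≤ Real.sqrt R :=
      (le_abs_self _).trans (Real.abs_le_sqrt ((norm_wake_sq_le hW c').trans hR'))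
    have hq := uniqueness_arith hapos hLR
    have hle : ‖c - c'‖ ≤ 1 / 2 * ‖c - c'‖ :=
      calc ‖c - c'‖ = ‖Φ c - Φ c'‖ := by rw [hfix, hfix']
        _ ≤ (2 * a)⁻¹ * (L * (‖W c‖ + ‖W c'‖)) * ‖c - c'‖ :=
            norm_Phi_sub_Phi_le hW hΦ h2a hβle hL c c'
        _ ≤ (2 * a)⁻¹ * (L * (Real.sqrt R + Real.sqrt R)) * ‖c - c'‖ := by gcongr
        _ ≤ 1 / 2 * ‖c - c'‖ := mul_le_mul_of_nonneg_right hq (norm_nonneg _)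
    have h0n : ‖c - c'‖ = 0 := by linarith [norm_nonneg (c - c')]
    exact sub_eq_zero.1 (norm_eq_zero.1 h0n)

end Summit.AnomalousDissipation.AnomalousDissipation.Theorems.WindLine
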